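import Literature.Computability.Cryptography.RegevSamplerMachineTab
import Literature.Computability.Cryptography.RegevSamplerSchedule
import Literature.Computability.Cryptography.RegevSamplerEtaCosWindow
import Literature.Computability.Cryptography.RegevSamplerSlack
import HarnessLib

/-!
# Regev 2009, Lemma 3.14 in machine form: the machine bound under the register schedule

Topic `Literature/Computability/Cryptography`, grouping namespace `Regev2009.SamplerRegs`; the capstone of
`RegevSamplerMachineTab.lean` (the machine bound `tvDist_machineCirc_le_tab` over an abstract level table, with
some twenty scalar window hypotheses) and `RegevSamplerSchedule.lean` (the explicit register schedule
`schedR/schedL/schedY/schedB` and the proof that it satisfies every window). Here the two are combined: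
`tvDist_machineCirc_le_sched` states the machine bound with the windows DISCHARGED — its remaining hypotheses are
the layout (`Fits`, room), the schedule equalities `Λ.ℓR = schedR n e T m`, …, the size data `|code B| ≤ e`,
`n ≤ e`, `2 ≤ e`, `5 ≤ n`, the width window `2^{-T} ≤ t ≤ 2^T`, Regev's promise `√n/t ≤ λ₁(L*)/2`, the query
format, the `CVP` family and the table accuracy — and its error term is
`8·√(weighted failure) + slack n ℓ ℓ_R (k_A+1) k_F Y (16·2⁻¹ⁿ) (etaCos ℓ k_A p μ (2π/D_t²))`.

Everything here is proved; no named fact is introduced.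

## References

* O. Regev, *On lattices, learning with errors, random linear codes, and cryptography*, J. ACM 56 (2009),
  art. 34, Lemma 3.14 (proof), Lemma 3.12 (proof) [Regev2009].
* L. Grover, T. Rudolph, *Creating superpositions that correspond to efficiently integrable probability
  distributions*, arXiv:quant-ph/0208112 (2002), eq. (1) [GroverRudolph2002].
-/

noncomputable section

namespace Literature.Computability.Cryptography

namespace Regev2009

namespace SamplerRegs

open Literature.Algebra.EuclideanLattices Literature.Algebra.EuclideanLattices.Regev2009
  Literature.Algebra.EuclideanLattices.Regev2009.QPart Literature.Computability.QuantumComplexity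
  Literature.Computability.QuantumComplexity.GaussianCells Literature.Computability.QuantumComplexity.GroverRudolph
  Literature.Computability.QuantumComplexity.GRWord Literature.Computability.QuantumComplexity.QFTQubits
  Literature.Computability.QuantumComplexity.QFTWord Literature.Computability.QuantumComplexity.TidyBlockFn
  Literature.Computability.QuantumComplexity.QState Literature.Computability.QuantumComplexity.GRMassTable
  Literature.Computability.QuantumComplexity.GRTableMach
  Literature.Computability.Complexity Literature.LinearAlgebra.Matrix.Berkowitz Peikert2009 Finset _root_.Matrix SamplerArith
  SamplerScale SamplerGeom SamplerWords SamplerWordFns SamplerFormats SamplerQuery CVPOracle SamplerClassical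
  SamplerClassical.Layout SamplerSubst SamplerDecode _root_.Computability Module
open Literature.Computability.QuantumComplexity.GRCosineMach (pcode abs_cosA_le_one cosA_update)
open scoped Real

variable (τ : LevelCode)

variable {W : ℕ} (I : LatticeInstance) {Λ : Layout W I.n} (hΛ : Λ.OK)

open Classical in
/-- **Regev 2009, Lemma 3.14 — the machine bound under the register schedule.** For a layout whose register
lengths follow the schedule (`ℓ_R = schedR n e T m`, `ℓ = schedL n e T m`, `ℓ_Y = schedY n e`, `b_c = schedB n e T`)
with `|code B| ≤ e`, `n ≤ e`, `2 ≤ e`, `5 ≤ n`, a stage width `2^{-T} ≤ t ≤ 2^T` satisfying Regev's promise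
`√n/t ≤ λ₁(L*)/2`, and a `2/2^p`-accurate level table for `c = 2π/D_t²`, the output law of the machine circuit is
within `8·√(weighted failure of the CVP family) + slack(…, Y, 16·2⁻¹ⁿ, etaCos ℓ k_A p μ c)` of
`intCoords_* D_{L(B), t/√2}` — every scalar window of `tvDist_machineCirc_le_tab` being discharged by
`RegevSamplerSchedule`. [cite: Regev2009, Lemma 3.14 (proof), Lemma 3.12 (proof)] [cite: GroverRudolph2002, eq. (1)] -/
theorem tvDist_machineCirc_le_sched [IsZLattice ℝ I.lattice] [NeZero I.n] (hF : Fits Λ) (hI : I.IsNonsingular)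
    {T e m : ℕ} (he : I.encode.length ≤ e) (hne : I.n ≤ e) (he2 : 2 ≤ e) (hn5 : 5 ≤ I.n)
    (hR : Λ.ℓR = schedR I.n e T m) (hL : Λ.ℓ = schedL I.n e T m) (hY : Λ.ℓY = schedY I.n e) (hB : Λ.bc = schedB I.n e T)
    {t : ℝ} (ht : 0 < t) (htT : t ≤ (2 : ℝ) ^ T) (hTt : (2⁻¹ : ℝ) ^ T ≤ t)
    (hd : Real.sqrt I.n / t ≤ minNorm (dualLattice I.lattice) / 2)
    (r : ℚ) (k : ℕ) (y : List Bool) (e' : ℚ) (Fq pad : List Bool)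
    (hFq0 : Fq = boolPair (boolPair (stageInput (GapSVPInstance.encode (I, r)) (k + 1) y) (boolPair (encodeNat Λ.ℓR) (encodeNat Λ.bc))) [])
    (hFq : Fq.length = Λ.Lq) (huz : (zoneOf Fq ((parOf I, 2 ^ Λ.ℓR), e') pad).length = Λ.L)
    (Rf : UniformQCircuitFamily) (Z : SubZone Λ (Rf.family.ancillas Λ.kq)) (hZ : ∀ s, Λ.base ≤ (Z.dirt s : ℕ))
    (S : ℚ) (p U kA np : ℕ) (hnp : (pcode ((S, (p, U)), (kA, Λ.ℓ))).length ≤ np)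
    {E : Fin I.n → (Fin (GRData.B Λ.ℓ np (wlen τ Λ.ℓ np) (kA + 1)) ↪ Fin W)} (hE : BlocksFit I Λ E (GRData.ws Λ.ℓ np (wlen τ Λ.ℓ np) (kA + 1)))
    (x' : EuclideanSpace ℝ (Fin I.n))
    (hT : Accurate (ℓ := Λ.ℓ) (2 * π / DT I (2 ^ Λ.ℓR) t ^ 2) (τ.tab S p U Λ.ℓ) (2 / (2 : ℝ) ^ p))
    {μ : ℝ} (hμ0 : 0 < μ) (hδμ : 4 * (2 / (2 : ℝ) ^ p) ≤ μ)
    (kF : ℕ) (hk : 1 ≤ kF) (hroom : Λ.base + I.n * QFTKit.qbsize Λ.ℓR kF ≤ W) :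
    ((bornPMF ((machineCirc I hΛ hF Rf Z (GRTableMach.data τ S p U kA Λ.ℓ np hnp) E
            (GRData.eraseList (mach τ S p U kA Λ.ℓ np hnp) E) kF hk hroom).runOn 0
          (basisState (boxLab E (GRData.ws Λ.ℓ np (wlen τ Λ.ℓ np) (kA + 1)) (GRData.init (mach τ S p U kA Λ.ℓ np hnp))
            (lab₀ I Λ (2 ^ Λ.ℓR) t (zoneOf Fq ((parOf I, 2 ^ Λ.ℓR), e') pad) x')
            fun _ => GRData.init (mach τ S p U kA Λ.ℓ np hnp) ∘ GRData.ws Λ.ℓ np (wlen τ Λ.ℓ np) (kA + 1))))).map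
        fun z => decZ I (2 ^ Λ.ℓR) (readS (Sblk I hΛ) z)).tvDist
      ((discreteGaussian I.lattice (t / Real.sqrt 2) 0).map I.intCoords) ≤
      8 * Real.sqrt (weightedFail Rf I r k y (Real.sqrt I.n / t)
              (dataLaw (boxSet I.n Λ.ℓ (DT I (2 ^ Λ.ℓR) t))
                (fun x => (gaussianFunction 1 x / zBox (boxSet I.n Λ.ℓ (DT I (2 ^ Λ.ℓR) t))) ^ 2) (fun _ _ => sq_nonneg _)
                (sum_boxWeight_eq_one (boxSet_nonempty I.n Λ.ℓ (DT I (2 ^ Λ.ℓR) t))) (cOf I Λ t))).toReal +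
        slack I.n Λ.ℓ Λ.ℓR (kA + 1) kF (Ysz I Λ t) (tailC I.n) (etaCos Λ.ℓ kA p μ (2 * π / DT I (2 ^ Λ.ℓR) t ^ 2)) := by
  have hn1 : 1 ≤ I.n := le_trans (by norm_num) hn5
  have hℓ1 : 1 ≤ Λ.ℓ := by rw [hL]; unfold schedL; omega
  have hℓY : 1 ≤ Λ.ℓY := by rw [hY]; unfold schedY; omega
  have hbc : 1 ≤ Λ.bc := by rw [hB]; unfold schedB; omega
  have hbcR : Λ.bc ≤ Λ.ℓR := by rw [hB, hR]; exact schedB_le_schedR I.n e T m he2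
  have hd2 : 2 * Real.sqrt (finrank ℝ (EuclideanSpace ℝ (Fin I.n))) ≤ t * minNorm (dualLattice I.lattice) := by
    rw [finrank_euclideanSpace_fin]; exact hd2_of_hd ht hd
  obtain ⟨hδ, hC⟩ := hδ_hC_sched I Λ hn1 ht htT he hne hR hL
  obtain ⟨hD, hw, -⟩ := window_sched I Λ ht htT hR hL (m := m) (e := e)
  have hηc : 2 * π / DT I (2 ^ Λ.ℓR) t ^ 2 * (2 * 2 ^ Λ.ℓ + 1) ≤ 2 := hηc_of hD (by omega)
  exact tvDist_machineCirc_le_tab τ I hΛ hF ht hℓ1 hℓY hbc hbcR hd hd2 (hRmin_sched I Λ hI hn1 ht htT hne hR)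
    (hRdec_sched I Λ ht htT he hne hR) (hfit_sched I Λ ht htT hTt he hne he2 hR hL) hδ hC (tailC_le_half hn5) (tailC_nonneg I.n)
    r k y e' Fq pad hFq0 hFq huz (fun Yb i => hyr_sched I Λ he hY (gridVec I Yb) i)
    (fun Yb _ i => hmr_sched I Λ he hne hR hL hB Yb i) Rf Z hZ S p U kA np hnp hE x' rfl hT hηc hμ0 hδμ kF hk hroom

open Classical in
/-- **Regev 2009, Lemma 3.14 — the machine bound with a negligible slack.** With the precision schedule
`k_A = 2m+1`, `k_F = 2m+4`, `p = 4(2m+ℓ+3)`, `μ = 8/4^{2m+ℓ+3}` and a precision parameter `m` dominating the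
register schedule (`schedL n e T 0 + 13 ≤ m`, i.e. `e(2e+2) + 4ne + 4T + 4e + 22 ≤ m`), the slack of `tvDist_machineCirc_le_sched` is below a
NEGLIGIBLE function `ν(n)` chosen once and for all (before the instance, the layout, the width and the `CVP`
family): the output law of the machine circuit is within `8·√(weighted failure) + ν(n)` of `intCoords_* D_{L(B), t/√2}`.
[cite: Regev2009, Lemma 3.14 (proof: "the output is within negligible distance of D_{L,r√n/(αq)}"), Lemma 3.12 (proof)]
[cite: GroverRudolph2002, eq. (1)] -/
theorem exists_negligible_tvDist_machineCirc_le :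
    ∃ ν : ℕ → ℝ, IsNegligible ν ∧
      ∀ {W : ℕ} (I : LatticeInstance) {Λ : Layout W I.n} (hΛ : Λ.OK) [IsZLattice ℝ I.lattice] [NeZero I.n]
        (hF : Fits Λ) (_hI : I.IsNonsingular) {T e m : ℕ} (_he : I.encode.length ≤ e) (_hne : I.n ≤ e) (_he2 : 2 ≤ e)
        (_hn5 : 5 ≤ I.n) (_hm : schedL I.n e T 0 + 13 ≤ m)
        (_hR : Λ.ℓR = schedR I.n e T m) (_hL : Λ.ℓ = schedL I.n e T m) (_hY : Λ.ℓY = schedY I.n e) (_hB : Λ.bc = schedB I.n e T)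
        {t : ℝ} (_ht : 0 < t) (_htT : t ≤ (2 : ℝ) ^ T) (_hTt : (2⁻¹ : ℝ) ^ T ≤ t)
        (_hd : Real.sqrt I.n / t ≤ minNorm (dualLattice I.lattice) / 2)
        (r : ℚ) (k : ℕ) (y : List Bool) (e' : ℚ) (Fq pad : List Bool)
        (_hFq0 : Fq = boolPair (boolPair (stageInput (GapSVPInstance.encode (I, r)) (k + 1) y) (boolPair (encodeNat Λ.ℓR) (encodeNat Λ.bc))) [])
        (_hFq : Fq.length = Λ.Lq) (_huz : (zoneOf Fq ((parOf I, 2 ^ Λ.ℓR), e') pad).length = Λ.L)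
        (Rf : UniformQCircuitFamily) (Z : SubZone Λ (Rf.family.ancillas Λ.kq)) (_hZ : ∀ s, Λ.base ≤ (Z.dirt s : ℕ))
        (S : ℚ) (U np : ℕ) (hnp : (pcode ((S, (4 * (2 * m + Λ.ℓ + 3), U)), (2 * m + 1, Λ.ℓ))).length ≤ np)
        {E : Fin I.n → (Fin (GRData.B Λ.ℓ np (wlen τ Λ.ℓ np) (2 * m + 1 + 1)) ↪ Fin W)}
        (_hE : BlocksFit I Λ E (GRData.ws Λ.ℓ np (wlen τ Λ.ℓ np) (2 * m + 1 + 1)))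
        (x' : EuclideanSpace ℝ (Fin I.n))
        (_hT : Accurate (ℓ := Λ.ℓ) (2 * π / DT I (2 ^ Λ.ℓR) t ^ 2) (τ.tab S (4 * (2 * m + Λ.ℓ + 3)) U Λ.ℓ) (2 / (2 : ℝ) ^ (4 * (2 * m + Λ.ℓ + 3))))
        (hroom : Λ.base + I.n * QFTKit.qbsize Λ.ℓR (2 * m + 4) ≤ W),
        ((bornPMF ((machineCirc I hΛ hF Rf Z (GRTableMach.data τ S (4 * (2 * m + Λ.ℓ + 3)) U (2 * m + 1) Λ.ℓ np hnp) E
                (GRData.eraseList (mach τ S (4 * (2 * m + Λ.ℓ + 3)) U (2 * m + 1) Λ.ℓ np hnp) E) (2 * m + 4) (by omega) hroom).runOn 0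
              (basisState (boxLab E (GRData.ws Λ.ℓ np (wlen τ Λ.ℓ np) (2 * m + 1 + 1))
                (GRData.init (mach τ S (4 * (2 * m + Λ.ℓ + 3)) U (2 * m + 1) Λ.ℓ np hnp))
                (lab₀ I Λ (2 ^ Λ.ℓR) t (zoneOf Fq ((parOf I, 2 ^ Λ.ℓR), e') pad) x')
                fun _ => GRData.init (mach τ S (4 * (2 * m + Λ.ℓ + 3)) U (2 * m + 1) Λ.ℓ np hnp) ∘
                  GRData.ws Λ.ℓ np (wlen τ Λ.ℓ np) (2 * m + 1 + 1))))).map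
            fun z => decZ I (2 ^ Λ.ℓR) (readS (Sblk I hΛ) z)).tvDist
          ((discreteGaussian I.lattice (t / Real.sqrt 2) 0).map I.intCoords) ≤
          8 * Real.sqrt (weightedFail Rf I r k y (Real.sqrt I.n / t)
                  (dataLaw (boxSet I.n Λ.ℓ (DT I (2 ^ Λ.ℓR) t))
                    (fun x => (gaussianFunction 1 x / zBox (boxSet I.n Λ.ℓ (DT I (2 ^ Λ.ℓR) t))) ^ 2) (fun _ _ => sq_nonneg _)
                    (sum_boxWeight_eq_one (boxSet_nonempty I.n Λ.ℓ (DT I (2 ^ Λ.ℓR) t))) (cOf I Λ t))).toReal + ν I.n := by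
  obtain ⟨ν, hν, hνb⟩ := exists_negligible_slack_le 2 16
  refine ⟨ν, hν, ?_⟩
  intro W I Λ hΛ _ _ hF hI T e m he hne he2 hn5 hm hR hL hY hB t ht htT hTt hd r k y e' Fq pad hFq0 hFq huz Rf Z hZ S U np hnp E hE x' hT hroom
  have h := tvDist_machineCirc_le_sched τ I hΛ hF hI he hne he2 hn5 hR hL hY hB ht htT hTt hd r k y e' Fq pad hFq0 hFq huz
    Rf Z hZ S (4 * (2 * m + Λ.ℓ + 3)) U (2 * m + 1) np hnp hE x' hT (schedule_mu_pos Λ.ℓ m) (schedule_delta_le_mu Λ.ℓ m)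
    (2 * m + 4) (by omega) hroom
  -- the slack is below `ν n`
  have hn1 : 1 ≤ I.n := le_trans (by norm_num) hn5
  have hLm : schedL I.n e T m = schedL I.n e T 0 + m := by unfold schedL schedR; omega
  have hem : e ≤ m := le_trans (by unfold schedL schedR; omega) hm
  have hnm : I.n ≤ m := hne.trans hem
  have h2m : 2 * m ≤ m ^ 2 := by rw [sq]; exact Nat.mul_le_mul_right m (by omega)
  have hℓm : Λ.ℓ ≤ m ^ 2 := le_trans (by rw [hL, hLm]; omega) h2m
  have hRL : schedR I.n e T m ≤ schedL I.n e T m := by unfold schedL; omega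
  have hℓRm : Λ.ℓR ≤ m ^ 2 := le_trans (by rw [hR]; omega) h2m
  have h6ℓ : 6 * Λ.ℓ + 1 ≤ m ^ 2 := by
    have h13 : 6 * Λ.ℓ + 1 ≤ 13 * m := by rw [hL, hLm]; omega
    exact h13.trans (by rw [sq]; exact Nat.mul_le_mul_right m (by omega))
  obtain ⟨-, -, hYm, -⟩ := Ysz_small I Λ ht.le htT he hne hR
  -- (no `linarith`/`nlinarith` below: they would parse the huge hypothesis `h`)
  have hm1 : (1 : ℝ) ≤ (m : ℝ) ^ 2 := one_le_pow₀ (by exact_mod_cast hn1.trans hnm)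
  have hYm' : Ysz I Λ t ≤ (m : ℝ) ^ 2 * (2⁻¹ : ℝ) ^ m :=
    hYm.trans (le_mul_of_one_le_left (by positivity) hm1)
  obtain ⟨hD, hw, -⟩ := window_sched I Λ ht htT hR hL (m := m) (e := e)
  have hη := etaCos_window_le (c := 2 * π / DT I (2 ^ Λ.ℓR) t ^ 2) rfl hD hw
  have hη' : etaCos Λ.ℓ (2 * m + 1) (4 * (2 * m + Λ.ℓ + 3)) (8 / 4 ^ (2 * m + Λ.ℓ + 3)) (2 * π / DT I (2 ^ Λ.ℓR) t ^ 2) ≤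
      (m : ℝ) ^ 2 * (2⁻¹ : ℝ) ^ m :=
    hη.trans (mul_le_mul_of_nonneg_right (by exact_mod_cast h6ℓ) (by positivity))
  have hη0 : 0 ≤ etaCos Λ.ℓ (2 * m + 1) (4 * (2 * m + Λ.ℓ + 3)) (8 / 4 ^ (2 * m + Λ.ℓ + 3)) (2 * π / DT I (2 ^ Λ.ℓR) t ^ 2) := by
    unfold etaCos; positivity
  have hC : tailC I.n ≤ 16 * (2⁻¹ : ℝ) ^ I.n := by unfold tailC; exact le_rfl
  have hs := hνb I.n m Λ.ℓ Λ.ℓR _ _ _ hn1 hnm hℓm hℓRm (Ysz_nonneg I Λ ht.le) hYm' hη0 hη' hC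
  have e22 : 2 * m + 1 + 1 = 2 * m + 2 := rfl
  rw [← e22] at hs
  refine h.trans ?_
  gcongr

end SamplerRegs

end Regev2009

end Literature.Computability.Cryptography

end
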